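import Mathlib
import Literature.NumberTheory.LFunctions.GeneralizedRH
import Summits.Parity.GeneralizedHardyLittlewood.Theses.LiouvilleMAD
import Summits.Parity.GeneralizedHardyLittlewood.Theorems.LiouvilleMADCosetDecorrelationStubNormalForm
import Summits.Parity.GeneralizedHardyLittlewood.Theorems.LiouvilleMADCosetDecorrelationStubQuasiRHOfProgressionMean
import Summits.Parity.GeneralizedHardyLittlewood.Theorems.LiouvilleMADCosetDecorrelationStubQuasiRHOfMeanMode
import Summits.Parity.GeneralizedHardyLittlewood.Theorems.LiouvilleMADCosetDecorrelationStubFluctModeIffMeanCorrected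
import Summits.Parity.GeneralizedHardyLittlewood.Theorems.LiouvilleMADCosetDecorrelationStubModesIff
import Summits.Parity.GeneralizedHardyLittlewood.Theorems.CosetDecorrelation.Negative.CosetDecorrelationDegenerations

/-!
# Line `Sketch` (card `gram-split-farey-phase`, ideator 2) for the crux `LiouvilleMAD.CosetDecorrelation`
(stmt-Parity-13317) — skeleton of the continuation lead `prover-line-stmt-Parity-13317-c2-0` (2026-08-16),
re-owned by the re-audit lead `prover-line-stmt-Parity-13317-c3-0` (2026-08-17, skeleton v2: the two periphery
stubs are now WIRED to their landed Theorems files p108799 / p108842 — `sorry` survives only in the two crux stubs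
M and F — and the honesty glue `stub_modesIff : (M ∧ F) ↔ (CosetDecorrelation ∧ M)` is registered, sorry-free),
built from `Cruxes/CosetDecorrelation/SketchIdeator2.lean` (rc 0, 0 sorry, composition
`cosetDecorrelation_of_modes : (∀ c ≠ 0, ∃ ϑ < 1/4, MeanMode c ϑ ∧ FluctMode c ϑ) → CosetDecorrelation`).

Crux (`T_j(n,n')` = the coset sum of the route file, verbatim):
`∀ c ≠ 0, ∃ ϑ < 1/4, ∃ C, ∀ M, 1 ≤ n ≠ n' ≤ 2M, j ∈ [⌊√M⌋+1, 2⌊√M⌋+2):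
  |Σ_{(m,m') ∈ (M,2M]², m ≡ m' (mod j)} λ(mn+c) λ(m'n'+c)| ≤ C · M^{3/4+ϑ}`.

**The seam (ideator 2).**  Gram form `T_j = Σ_{a<j} A_n(a)A_{n'}(a)`, `A_n(a) = Σ_{m∈(M,2M], m % j = a} λ(mn+c)`, and the
mean/fluctuation split `T_j = S(n)S(n')/j + Σ_a (A_n(a) − S(n)/j)(A_{n'}(a) − S(n')/j)`, `S(n) = Σ_{m∈(M,2M]} λ(mn+c)`.
The line is the two-stub conjunction (ideator 2's `MeanMode ∧ FluctMode`, here as two families so that each is a registered stub;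
a joint `ϑ` is recovered by `max`):

* `stub_meanMode` (M, rank-one / level-1): `|S(n)S(n')/j| ≤ C·M^{3/4+ϑ}`, `ϑ < 1/4`, on the crux's ranges (product form).  OPEN:
  quasi-RH(3/4)-grade already at `c = 2`, `(n,n') = (1,2)` (periphery stub `stub_quasiRH_of_meanMode`), and beyond GRH once one
  dilation is `≍ M` (GRH's `(Mn)^{1/2+ε} ≥ M` is trivial there; the partner factor would have to be `≤ M^{1/2−κ}`, below its typical size).
* `stub_fluctMode` (F, the residual): `|Σ_{a<j} (A_n(a) − S(n)/j)(A_{n'}(a) − S(n')/j)| ≤ C·M^{3/4+ϑ}` on the crux's ranges.  OPEN,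
  crux-grade: by the mean-coupling identity it IS the mean-corrected crux K1 of line `SketchIdeator3` (periphery stub
  `stub_fluctMode_iff_meanCorrected`), which is the crux modulo the one-point stub (`FareyLevelMeanCoupling.stub_splitIff`, p108330).

**Composition** `CosetDecorrelation_of : M → F → CosetDecorrelation` is PROVED below (identity + triangle inequality, `ϑ := max ϑ₁ ϑ₂`).
**Periphery** (calibration / honesty, registered so that their Theorems files land `--supports`):
`stub_quasiRH_of_meanMode : M → ∃ θ < 3/4, QuasiRiemannHypothesis θ` and `stub_fluctMode_iff_meanCorrected : F ↔ K1`.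

**Disproof used** (`Cruxes/CosetDecorrelation/Disproof.lean`, cdisprove cycle 1): no kill, nothing misstated; `c ≠ 0`, `n ≠ n'` kept
verbatim in every stub (`Negative.shift_zero`, `Negative.equalDilations_nonneg`); no stub has a window parameter.

All registered statements are DEF-FREE (route vocabulary; classes spelled `m % j = a` exactly as in ideator 2's `classSum`).
-/

namespace Summit.Parity.GeneralizedHardyLittlewood.Cruxes.CosetDecorrelation.GramSplitFareyPhase

open Finset
open Summit.Parity.GeneralizedHardyLittlewood.Theses.LiouvilleMAD (CosetDecorrelation)

/-! ## The two crux stubs: named statements -/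

/-- M — MEAN MODE family (ideator 2's `MeanMode c ϑ` for every `c ≠ 0` with some `ϑ < 1/4`): the level-1 term `S(n)S(n')/j`
of the coset sum is `≤ C·M^{3/4+ϑ}` on the crux's ranges.  OPEN (quasi-RH(3/4)-grade at bounded dilations, beyond GRH at `n ≍ M`). -/
def MeanModeFamily : Prop :=
  ∀ c : ℤ, c ≠ 0 → ∃ ϑ : ℝ, ϑ < 1 / 4 ∧ ∃ C : ℝ, ∀ M n n' j : ℕ, 1 ≤ n → 1 ≤ n' → n ≠ n' →
    n ≤ 2 * M → n' ≤ 2 * M → Nat.sqrt M + 1 ≤ j → j < 2 * (Nat.sqrt M + 1) →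
      |(∑ m ∈ Finset.Ioc M (2 * M), (ArithmeticFunction.liouville (Int.toNat ((m : ℤ) * n + c)) : ℝ)) *
          (∑ m ∈ Finset.Ioc M (2 * M), (ArithmeticFunction.liouville (Int.toNat ((m : ℤ) * n' + c)) : ℝ)) /
            (j : ℝ)| ≤ C * (M : ℝ) ^ (3 / 4 + ϑ)

/-- F — FLUCTUATION MODE family (ideator 2's `FluctMode c ϑ` for every `c ≠ 0` with some `ϑ < 1/4`): the mean-free class
profiles decorrelate.  OPEN, crux-grade (= K1 of line `SketchIdeator3` by `stub_fluctMode_iff_meanCorrected`). -/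
def FluctModeFamily : Prop :=
  ∀ c : ℤ, c ≠ 0 → ∃ ϑ : ℝ, ϑ < 1 / 4 ∧ ∃ C : ℝ, ∀ M n n' j : ℕ, 1 ≤ n → 1 ≤ n' → n ≠ n' →
    n ≤ 2 * M → n' ≤ 2 * M → Nat.sqrt M + 1 ≤ j → j < 2 * (Nat.sqrt M + 1) →
      |∑ a ∈ Finset.range j,
          ((∑ m ∈ (Finset.Ioc M (2 * M)).filter (fun m => m % j = a),
              (ArithmeticFunction.liouville (Int.toNat ((m : ℤ) * n + c)) : ℝ))
            - (∑ m ∈ Finset.Ioc M (2 * M),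
                (ArithmeticFunction.liouville (Int.toNat ((m : ℤ) * n + c)) : ℝ)) / (j : ℝ)) *
          ((∑ m ∈ (Finset.Ioc M (2 * M)).filter (fun m => m % j = a),
              (ArithmeticFunction.liouville (Int.toNat ((m : ℤ) * n' + c)) : ℝ))
            - (∑ m ∈ Finset.Ioc M (2 * M),
                (ArithmeticFunction.liouville (Int.toNat ((m : ℤ) * n' + c)) : ℝ)) / (j : ℝ))|
        ≤ C * (M : ℝ) ^ (3 / 4 + ϑ)

/-! ## Registered stubs (`sorry` lives only in `stub_*`) -/

/-- **STUB M · `stub_meanMode`** (= `MeanModeFamily` verbatim).  OPEN (size XL; ⊇ quasi-RH(3/4)). -/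
theorem stub_meanMode :
    ∀ c : ℤ, c ≠ 0 → ∃ ϑ : ℝ, ϑ < 1 / 4 ∧ ∃ C : ℝ, ∀ M n n' j : ℕ, 1 ≤ n → 1 ≤ n' → n ≠ n' →
    n ≤ 2 * M → n' ≤ 2 * M → Nat.sqrt M + 1 ≤ j → j < 2 * (Nat.sqrt M + 1) →
      |(∑ m ∈ Finset.Ioc M (2 * M), (ArithmeticFunction.liouville (Int.toNat ((m : ℤ) * n + c)) : ℝ)) *
          (∑ m ∈ Finset.Ioc M (2 * M), (ArithmeticFunction.liouville (Int.toNat ((m : ℤ) * n' + c)) : ℝ)) /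
            (j : ℝ)| ≤ C * (M : ℝ) ^ (3 / 4 + ϑ) := by
  sorry

/-- **STUB F · `stub_fluctMode`** (= `FluctModeFamily` verbatim) — the residual; held by the lead.  OPEN, crux-grade (size XL). -/
theorem stub_fluctMode :
    ∀ c : ℤ, c ≠ 0 → ∃ ϑ : ℝ, ϑ < 1 / 4 ∧ ∃ C : ℝ, ∀ M n n' j : ℕ, 1 ≤ n → 1 ≤ n' → n ≠ n' →
    n ≤ 2 * M → n' ≤ 2 * M → Nat.sqrt M + 1 ≤ j → j < 2 * (Nat.sqrt M + 1) →
      |∑ a ∈ Finset.range j,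
          ((∑ m ∈ (Finset.Ioc M (2 * M)).filter (fun m => m % j = a),
              (ArithmeticFunction.liouville (Int.toNat ((m : ℤ) * n + c)) : ℝ))
            - (∑ m ∈ Finset.Ioc M (2 * M),
                (ArithmeticFunction.liouville (Int.toNat ((m : ℤ) * n + c)) : ℝ)) / (j : ℝ)) *
          ((∑ m ∈ (Finset.Ioc M (2 * M)).filter (fun m => m % j = a),
              (ArithmeticFunction.liouville (Int.toNat ((m : ℤ) * n' + c)) : ℝ))
            - (∑ m ∈ Finset.Ioc M (2 * M),
                (ArithmeticFunction.liouville (Int.toNat ((m : ℤ) * n' + c)) : ℝ)) / (j : ℝ))|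
        ≤ C * (M : ℝ) ^ (3 / 4 + ϑ) := by
  sorry

/-- **STUB P1 · `stub_quasiRH_of_meanMode`** (periphery, CALIBRATION OF M): the mean-mode family implies the quasi-Riemann
hypothesis at some abscissa `θ < 3/4` (`Literature.NumberTheory.LFunctions.QuasiRiemannHypothesis θ`).  Route: `c = 2`,
`(n,n') = (1,2)`, `j = ⌊√M⌋+1`: `S(2) = −B_M`, `S(1) = B_M ± 2`, `B_M = Σ_{m∈(M,2M]} λ(m+1)`, so `|B_M|² ≤ (2C+2) M^{5/4+ϑ⁺}`; then
binary descent + `μ = λ ∗ (μ∘√)` + the Mertens dictionary (tree, PROVED), exactly as in `stub_quasiRH_of_progressionMean` (p97406). -/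
theorem stub_quasiRH_of_meanMode :
    (∀ c : ℤ, c ≠ 0 → ∃ ϑ : ℝ, ϑ < 1 / 4 ∧ ∃ C : ℝ, ∀ M n n' j : ℕ, 1 ≤ n → 1 ≤ n' → n ≠ n' →
      n ≤ 2 * M → n' ≤ 2 * M → Nat.sqrt M + 1 ≤ j → j < 2 * (Nat.sqrt M + 1) →
        |(∑ m ∈ Finset.Ioc M (2 * M), (ArithmeticFunction.liouville (Int.toNat ((m : ℤ) * n + c)) : ℝ)) *
            (∑ m ∈ Finset.Ioc M (2 * M), (ArithmeticFunction.liouville (Int.toNat ((m : ℤ) * n' + c)) : ℝ)) /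
              (j : ℝ)| ≤ C * (M : ℝ) ^ (3 / 4 + ϑ)) →
      ∃ θ : ℝ, θ < 3 / 4 ∧ Literature.NumberTheory.LFunctions.QuasiRiemannHypothesis θ :=
  -- LANDED: p108799, `Theorems/LiouvilleMADCosetDecorrelationStubQuasiRHOfMeanMode.lean`
  _root_.Summit.Parity.GeneralizedHardyLittlewood.Theorems.CosetDecorrelation.GramSplitFareyPhase.stub_quasiRH_of_meanMode

/-- **STUB P2 · `stub_fluctMode_iff_meanCorrected`** (periphery, HONESTY OF THE RESIDUAL): the fluctuation family F is
EQUIVALENT, instance by instance with the same `ϑ` and `C`, to the mean-corrected coset decorrelation K1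
(`FareyLevelMeanCoupling.MeanCorrectedCosetDecorrelation`, the registered residual of line `SketchIdeator3`), by the mean-coupling
identity `stub_normalForm` (p96729) with the classes re-spelled (`m % j = a ↔ m ≡ a (mod j)` for `a < j`). -/
theorem stub_fluctMode_iff_meanCorrected :
    (∀ c : ℤ, c ≠ 0 → ∃ ϑ : ℝ, ϑ < 1 / 4 ∧ ∃ C : ℝ, ∀ M n n' j : ℕ, 1 ≤ n → 1 ≤ n' → n ≠ n' →
      n ≤ 2 * M → n' ≤ 2 * M → Nat.sqrt M + 1 ≤ j → j < 2 * (Nat.sqrt M + 1) →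
        |∑ a ∈ Finset.range j,
            ((∑ m ∈ (Finset.Ioc M (2 * M)).filter (fun m => m % j = a),
                (ArithmeticFunction.liouville (Int.toNat ((m : ℤ) * n + c)) : ℝ))
              - (∑ m ∈ Finset.Ioc M (2 * M),
                  (ArithmeticFunction.liouville (Int.toNat ((m : ℤ) * n + c)) : ℝ)) / (j : ℝ)) *
            ((∑ m ∈ (Finset.Ioc M (2 * M)).filter (fun m => m % j = a),
                (ArithmeticFunction.liouville (Int.toNat ((m : ℤ) * n' + c)) : ℝ))
              - (∑ m ∈ Finset.Ioc M (2 * M),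
                  (ArithmeticFunction.liouville (Int.toNat ((m : ℤ) * n' + c)) : ℝ)) / (j : ℝ))|
          ≤ C * (M : ℝ) ^ (3 / 4 + ϑ)) ↔
    (∀ c : ℤ, c ≠ 0 → ∃ ϑ : ℝ, ϑ < 1 / 4 ∧ ∃ C : ℝ, ∀ M n n' j : ℕ, 1 ≤ n → 1 ≤ n' → n ≠ n' →
      n ≤ 2 * M → n' ≤ 2 * M → Nat.sqrt M + 1 ≤ j → j < 2 * (Nat.sqrt M + 1) →
        |(∑ p ∈ (Finset.Ioc M (2 * M) ×ˢ Finset.Ioc M (2 * M)).filter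
              (fun p : ℕ × ℕ => p.1 ≡ p.2 [MOD j]),
            (ArithmeticFunction.liouville (Int.toNat ((p.1 : ℤ) * n + c)) : ℝ) *
              (ArithmeticFunction.liouville (Int.toNat ((p.2 : ℤ) * n' + c)) : ℝ))
          - (∑ m ∈ Finset.Ioc M (2 * M), (ArithmeticFunction.liouville (Int.toNat ((m : ℤ) * n + c)) : ℝ)) *
              (∑ m ∈ Finset.Ioc M (2 * M), (ArithmeticFunction.liouville (Int.toNat ((m : ℤ) * n' + c)) : ℝ)) /
                (j : ℝ)|
          ≤ C * (M : ℝ) ^ (3 / 4 + ϑ)) :=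
  -- LANDED: p108842, `Theorems/LiouvilleMADCosetDecorrelationStubFluctModeIffMeanCorrected.lean`
  _root_.Summit.Parity.GeneralizedHardyLittlewood.Theorems.CosetDecorrelation.GramSplitFareyPhase.stub_fluctMode_iff_meanCorrected

/-! ### Consistency: each named crux statement IS its registered stub (definitionally) -/

theorem meanModeFamily_holds : MeanModeFamily := stub_meanMode
theorem fluctModeFamily_holds : FluctModeFamily := stub_fluctMode

/-- Grade of M, by name: the mean-mode family implies quasi-RH at some abscissa `< 3/4`. -/
theorem quasiRH_of_meanModeFamily (h : MeanModeFamily) :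
    ∃ θ : ℝ, θ < 3 / 4 ∧ Literature.NumberTheory.LFunctions.QuasiRiemannHypothesis θ :=
  stub_quasiRH_of_meanMode h

/-! ### Name-keyed aliases of the two crux statements (the hypotheses of the composition) -/
namespace Registered

/-- Alias of `MeanModeFamily` keyed by the registered stub name. -/
abbrev stub_meanMode : Prop := MeanModeFamily
/-- Alias of `FluctModeFamily` keyed by the registered stub name. -/
abbrev stub_fluctMode : Prop := FluctModeFamily

end Registered

/-! ## Glue (sorry-free): the mean/fluctuation identity in ideator 2's spelling -/

/-- For `a < j`, the residue class cut out by `m % j = a` is the class `m ≡ a (mod j)`. -/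
theorem filter_mod_eq (s : Finset ℕ) {j a : ℕ} (ha : a < j) :
    s.filter (fun m => m % j = a) = s.filter (fun m => m ≡ a [MOD j]) := by
  refine Finset.filter_congr fun m _ => ?_
  rw [Nat.ModEq, Nat.mod_eq_of_lt ha]

/-- GRAM SPLIT (general real weights, `j ≥ 1`): coset sum = level-1 term + mean-free inner product, classes `m % j = a`.
(`FareyLevelMeanCoupling.stub_normalForm`, p96729, re-spelled.) -/
theorem gram_split (f g : ℕ → ℝ) (M j : ℕ) (hj : 1 ≤ j) :
    (∑ p ∈ (Finset.Ioc M (2 * M) ×ˢ Finset.Ioc M (2 * M)).filter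
        (fun p : ℕ × ℕ => p.1 ≡ p.2 [MOD j]), f p.1 * g p.2)
      = (∑ m ∈ Finset.Ioc M (2 * M), f m) * (∑ m ∈ Finset.Ioc M (2 * M), g m) / (j : ℝ)
        + ∑ a ∈ Finset.range j,
            ((∑ m ∈ (Finset.Ioc M (2 * M)).filter (fun m => m % j = a), f m)
                - (∑ m ∈ Finset.Ioc M (2 * M), f m) / (j : ℝ)) *
              ((∑ m ∈ (Finset.Ioc M (2 * M)).filter (fun m => m % j = a), g m)
                - (∑ m ∈ Finset.Ioc M (2 * M), g m) / (j : ℝ)) := by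
  have h := Summit.Parity.GeneralizedHardyLittlewood.Theorems.CosetDecorrelation.FareyLevelMeanCoupling.stub_normalForm
    f g M j hj
  have h' : ∑ a ∈ Finset.range j,
      ((∑ m ∈ (Finset.Ioc M (2 * M)).filter (fun m => m % j = a), f m)
          - (∑ m ∈ Finset.Ioc M (2 * M), f m) / (j : ℝ)) *
        ((∑ m ∈ (Finset.Ioc M (2 * M)).filter (fun m => m % j = a), g m)
          - (∑ m ∈ Finset.Ioc M (2 * M), g m) / (j : ℝ))
      = ∑ a ∈ Finset.range j,
          ((∑ m ∈ (Finset.Ioc M (2 * M)).filter (fun m => m ≡ a [MOD j]), f m)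
              - (∑ m ∈ Finset.Ioc M (2 * M), f m) / (j : ℝ)) *
            ((∑ m ∈ (Finset.Ioc M (2 * M)).filter (fun m => m ≡ a [MOD j]), g m)
              - (∑ m ∈ Finset.Ioc M (2 * M), g m) / (j : ℝ)) :=
    Finset.sum_congr rfl fun a ha => by rw [filter_mod_eq _ (Finset.mem_range.mp ha)]
  rw [h', ← h]
  ring

/-! ## The composition: M → F → crux, BY NAME (kernel-checked; no `sorry` below this line) -/

/-- **`CosetDecorrelation_of`** — the glue of the line: `T_j = S S'/j + (fluctuation)` (`gram_split`), triangle inequality,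
M on the first term and F on the second, `ϑ := max ϑ₁ ϑ₂ < 1/4`, `C := max C₁ 0 + max C₂ 0`. -/
theorem CosetDecorrelation_of (h1 : Registered.stub_meanMode) (h2 : Registered.stub_fluctMode) :
    CosetDecorrelation := by
  intro c hc
  obtain ⟨ϑ₁, hϑ₁, C₁, hMean⟩ := h1 c hc
  obtain ⟨ϑ₂, hϑ₂, C₂, hFluct⟩ := h2 c hc
  refine ⟨max ϑ₁ ϑ₂, max_lt hϑ₁ hϑ₂, max C₁ 0 + max C₂ 0, ?_⟩
  intro M n n' j hn hn' hne hnM hn'M hj1 hj2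
  have hM : 1 ≤ M := by omega
  have hMr : (1 : ℝ) ≤ M := by exact_mod_cast hM
  have hMpos : (0 : ℝ) < M := by linarith
  have hj : 1 ≤ j := le_trans (Nat.succ_le_succ (Nat.zero_le _)) hj1
  have e1 := hMean M n n' j hn hn' hne hnM hn'M hj1 hj2
  have e2 := hFluct M n n' j hn hn' hne hnM hn'M hj1 hj2
  have hsplit := gram_split
    (fun m => (ArithmeticFunction.liouville (Int.toNat ((m : ℤ) * n + c)) : ℝ))
    (fun m => (ArithmeticFunction.liouville (Int.toNat ((m : ℤ) * n' + c)) : ℝ)) M j hj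
  rw [hsplit]
  -- monotonicity in the exponent (M ≥ 1) and nonnegative constants
  have m1 : (M : ℝ) ^ (3 / 4 + ϑ₁) ≤ (M : ℝ) ^ (3 / 4 + max ϑ₁ ϑ₂) :=
    Real.rpow_le_rpow_of_exponent_le hMr (by linarith [le_max_left ϑ₁ ϑ₂])
  have m2 : (M : ℝ) ^ (3 / 4 + ϑ₂) ≤ (M : ℝ) ^ (3 / 4 + max ϑ₁ ϑ₂) :=
    Real.rpow_le_rpow_of_exponent_le hMr (by linarith [le_max_right ϑ₁ ϑ₂])
  have p1 : 0 ≤ (M : ℝ) ^ (3 / 4 + ϑ₁) := Real.rpow_nonneg hMpos.le _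
  have p2 : 0 ≤ (M : ℝ) ^ (3 / 4 + ϑ₂) := Real.rpow_nonneg hMpos.le _
  have e1' := (e1.trans (mul_le_mul_of_nonneg_right (le_max_left C₁ 0) p1)).trans
    (mul_le_mul_of_nonneg_left m1 (le_max_right C₁ 0))
  have e2' := (e2.trans (mul_le_mul_of_nonneg_right (le_max_left C₂ 0) p2)).trans
    (mul_le_mul_of_nonneg_left m2 (le_max_right C₂ 0))
  calc _ ≤ _ := abs_add_le _ _
    _ ≤ max C₁ 0 * (M : ℝ) ^ (3 / 4 + max ϑ₁ ϑ₂) + max C₂ 0 * (M : ℝ) ^ (3 / 4 + max ϑ₁ ϑ₂) :=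
        add_le_add e1' e2'
    _ = (max C₁ 0 + max C₂ 0) * (M : ℝ) ^ (3 / 4 + max ϑ₁ ϑ₂) := by ring

/-- Wiring check: the registered stubs feed `CosetDecorrelation_of` as stated. -/
example : CosetDecorrelation := CosetDecorrelation_of stub_meanMode stub_fluctMode

/-! ## Honesty: where the two stubs sit (sorry-free modulo the periphery stubs) -/

/-- The residual F is the mean-corrected crux K1 of line `SketchIdeator3`, by name. -/
theorem fluctModeFamily_iff_meanCorrected :
    FluctModeFamily ↔
    (∀ c : ℤ, c ≠ 0 → ∃ ϑ : ℝ, ϑ < 1 / 4 ∧ ∃ C : ℝ, ∀ M n n' j : ℕ, 1 ≤ n → 1 ≤ n' → n ≠ n' →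
      n ≤ 2 * M → n' ≤ 2 * M → Nat.sqrt M + 1 ≤ j → j < 2 * (Nat.sqrt M + 1) →
        |(∑ p ∈ (Finset.Ioc M (2 * M) ×ˢ Finset.Ioc M (2 * M)).filter
              (fun p : ℕ × ℕ => p.1 ≡ p.2 [MOD j]),
            (ArithmeticFunction.liouville (Int.toNat ((p.1 : ℤ) * n + c)) : ℝ) *
              (ArithmeticFunction.liouville (Int.toNat ((p.2 : ℤ) * n' + c)) : ℝ))
          - (∑ m ∈ Finset.Ioc M (2 * M), (ArithmeticFunction.liouville (Int.toNat ((m : ℤ) * n + c)) : ℝ)) *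
              (∑ m ∈ Finset.Ioc M (2 * M), (ArithmeticFunction.liouville (Int.toNat ((m : ℤ) * n' + c)) : ℝ)) /
                (j : ℝ)|
          ≤ C * (M : ℝ) ^ (3 / 4 + ϑ)) :=
  stub_fluctMode_iff_meanCorrected

/-- M implies the K2-type level-1 debt is at least quasi-RH(3/4): restated by name. -/
example (h : MeanModeFamily) : ∃ θ : ℝ, θ < 3 / 4 ∧ Literature.NumberTheory.LFunctions.QuasiRiemannHypothesis θ :=
  quasiRH_of_meanModeFamily h

/-! ## Honesty of the line as a whole (re-audit lead c3): `(M ∧ F) ↔ (crux ∧ M)` — landed glue p137391 -/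

/-- **STUB P3 · `stub_modesIff`** (glue, HONESTY OF THE LINE AS A WHOLE; registered by the re-audit lead c3, sorry-free):
the line's stub pair is the crux plus its mean-mode debt — `(M ∧ F) ↔ (CosetDecorrelation ∧ M)`.  Given M, the residual F is
EQUIVALENT to the crux itself; and M ⇒ quasi-RH(θ<3/4) (P1).  LANDED p137391. -/
theorem stub_modesIff :
    ((∀ c : ℤ, c ≠ 0 → ∃ ϑ : ℝ, ϑ < 1 / 4 ∧ ∃ C : ℝ, ∀ M n n' j : ℕ, 1 ≤ n → 1 ≤ n' → n ≠ n' →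
      n ≤ 2 * M → n' ≤ 2 * M → Nat.sqrt M + 1 ≤ j → j < 2 * (Nat.sqrt M + 1) →
        |(∑ m ∈ Finset.Ioc M (2 * M), (ArithmeticFunction.liouville (Int.toNat ((m : ℤ) * n + c)) : ℝ)) *
            (∑ m ∈ Finset.Ioc M (2 * M), (ArithmeticFunction.liouville (Int.toNat ((m : ℤ) * n' + c)) : ℝ)) /
              (j : ℝ)| ≤ C * (M : ℝ) ^ (3 / 4 + ϑ)) ∧
     (∀ c : ℤ, c ≠ 0 → ∃ ϑ : ℝ, ϑ < 1 / 4 ∧ ∃ C : ℝ, ∀ M n n' j : ℕ, 1 ≤ n → 1 ≤ n' → n ≠ n' →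
      n ≤ 2 * M → n' ≤ 2 * M → Nat.sqrt M + 1 ≤ j → j < 2 * (Nat.sqrt M + 1) →
        |∑ a ∈ Finset.range j,
            ((∑ m ∈ (Finset.Ioc M (2 * M)).filter (fun m => m % j = a),
                (ArithmeticFunction.liouville (Int.toNat ((m : ℤ) * n + c)) : ℝ))
              - (∑ m ∈ Finset.Ioc M (2 * M),
                  (ArithmeticFunction.liouville (Int.toNat ((m : ℤ) * n + c)) : ℝ)) / (j : ℝ)) *
            ((∑ m ∈ (Finset.Ioc M (2 * M)).filter (fun m => m % j = a),
                (ArithmeticFunction.liouville (Int.toNat ((m : ℤ) * n' + c)) : ℝ))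
              - (∑ m ∈ Finset.Ioc M (2 * M),
                  (ArithmeticFunction.liouville (Int.toNat ((m : ℤ) * n' + c)) : ℝ)) / (j : ℝ))|
          ≤ C * (M : ℝ) ^ (3 / 4 + ϑ))) ↔
    (Summit.Parity.GeneralizedHardyLittlewood.Theses.LiouvilleMAD.CosetDecorrelation ∧
     (∀ c : ℤ, c ≠ 0 → ∃ ϑ : ℝ, ϑ < 1 / 4 ∧ ∃ C : ℝ, ∀ M n n' j : ℕ, 1 ≤ n → 1 ≤ n' → n ≠ n' →
      n ≤ 2 * M → n' ≤ 2 * M → Nat.sqrt M + 1 ≤ j → j < 2 * (Nat.sqrt M + 1) →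
        |(∑ m ∈ Finset.Ioc M (2 * M), (ArithmeticFunction.liouville (Int.toNat ((m : ℤ) * n + c)) : ℝ)) *
            (∑ m ∈ Finset.Ioc M (2 * M), (ArithmeticFunction.liouville (Int.toNat ((m : ℤ) * n' + c)) : ℝ)) /
              (j : ℝ)| ≤ C * (M : ℝ) ^ (3 / 4 + ϑ))) :=
  -- LANDED: p137391, `Theorems/LiouvilleMADCosetDecorrelationStubModesIff.lean` (its `→` direction is this file's
  -- `CosetDecorrelation_of` re-proved importably as `GramSplitFareyPhase.cosetDecorrelation_of_modes`)
  _root_.Summit.Parity.GeneralizedHardyLittlewood.Theorems.CosetDecorrelation.GramSplitFareyPhase.stub_modesIff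

/-- The line as a whole, by name: `Sketch` = crux ∧ M (so it is the crux made harder by a quasi-RH(3/4)-grade debt). -/
theorem line_iff : (MeanModeFamily ∧ FluctModeFamily) ↔ (CosetDecorrelation ∧ MeanModeFamily) := stub_modesIff

end Summit.Parity.GeneralizedHardyLittlewood.Cruxes.CosetDecorrelation.GramSplitFareyPhase
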